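import Summits.CriticalPhenomena.PercolationContinuityZ3.Theorems.PercNearOneGluingNoHeavyQuantWindowExtremeSmall
import HarnessLib

/-!
# QUANT lane R8, T-DEC: AT AN EXTREME POINT OF THE WINDOW POLYTOPE THE LAW IS ITS OWN PIECE VECTOR — the proportionality form of
# census-2 g57's `smallLaw_of_pieces`, and the cases (C) (no saturated layer) and (A) (a giant above the top) of memo WINDOW-ATOMS-G57
# §2.4 read structurally: there the extreme point charges AT MOST ONE low of the top layer

builds on p205010 (kernel theorem, internal audit signed; external expert review pending)

Support file (`--supports stmt-CriticalPhenomena-4575`), QUANT lane seat prim-quant-census-2 (gen 58), rung R8 of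
`run/shared/lean/prim/quant/LADDER.md`.  Theorems only, standard axioms, no sorries.  Memo `…/prim-quant-census-2-g58/EXTREME-ATOMS-G58.md` §1.

* **`LawDec.law_eq_of_pieces`** — admissible pieces (the hypotheses of g57's `exists_oneSided`) that move mass somewhere on `{0..M}` give, at an
  extreme point `v`, a constant `s ≠ 0` with `pertLaw − μ = s·μ` on `{0..M}` (`μ = vecLaw M v`), and every charged position is named by an active
  piece (g57 kept only the second half, as `SmallLaw`).
* `LawDec.eq_of_smul_eq_smul` — two probability vectors on `{0..M}` that are proportional are equal.
* **`LawDec.atMostOneLow_of_noTight`** (case (C)), **`LawDec.atMostOneLow_of_tight_giant`** (case (A)): the law is a giant point / a corner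
  segment / an absorber point, resp. `u·e_g + e_l₀` / `(e_l₀ + c₀e_h₀) + (u − c₀)e_g` up to scale — in every sub-case at most one low of layer `j`
  carries mass.  Case (B) and the assembly are in `…QuantWindowExtremeShape`.

[this work]; nothing here is cited as a published result.  The gluing rows served [cite: KozmaNitzan2024, Conjecture 3 (p. 15)]; product
measure [cite: Grimmett1999, §1.3 p. 10].
-/

noncomputable section

namespace Summit.CriticalPhenomena.PercolationContinuityZ3.Theorems

namespace Quant

open Finset

namespace LawDec

/-- indicator of equality of naturals, as a real number -/
local notation3 "𝟙[" a ", " b "]" => (if (a : ℕ) = (b : ℕ) then (1 : ℝ) else 0)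

/-- **PROPORTIONALITY AT AN EXTREME POINT** (the first half of census-2 g57's `smallLaw_of_pieces`, with the conclusion kept explicit):
admissible pieces (hypotheses of `exists_oneSided`) that move mass at some position `≤ M` are a two-sided move, so at an extreme point of the
window polytope the move is proportional to the law: `pertLaw − μ = s·μ` on `{0..M}` with `s ≠ 0`; in particular every charged position is
named by an active piece. [this work] -/
theorem law_eq_of_pieces (x T : ℝ) (M j w : ℕ) (v : Fin (M + 1) → ℝ) (hx0 : 0 < x) (hx1 : x < 1)
    (hvext : v ∈ (windowSet x T M j w).extremePoints ℝ) (l₁ h₁ l₂ h₂ g₁ g₂ l₀ : ℕ) (t₁ t₂ s₁ s₂ r : ℝ)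
    (hσ₁ : t₁ ≠ 0 → 0 < cornerMidFlow x T j M (vecLaw M v) l₁ h₁)
    (hσ₂ : t₂ ≠ 0 → 0 < cornerMidFlow x T j M (vecLaw M v) l₂ h₂)
    (hg₁ : s₁ ≠ 0 → g₁ ≤ M ∧ ¬ (2 * (g₁ : ℝ) < T ∧ g₁ ≤ j) ∧
      0 < vecLaw M v g₁ - ∑ a ∈ Finset.range (j + 1), usage x T j a g₁ * cornerMidFlow x T j M (vecLaw M v) a g₁)
    (hg₂ : s₂ ≠ 0 → g₂ ≤ M ∧ ¬ (2 * (g₂ : ℝ) < T ∧ g₂ ≤ j) ∧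
      0 < vecLaw M v g₂ - ∑ a ∈ Finset.range (j + 1), usage x T j a g₂ * cornerMidFlow x T j M (vecLaw M v) a g₂)
    (hl₀ : r ≠ 0 → 2 * (l₀ : ℝ) < T ∧ l₀ ≤ j ∧ 0 < cornerLeftover x T j M (vecLaw M v) l₀)
    (hG : ∀ J, J ≤ j → j ≤ J + w → (∀ l, J < l → l ≤ j → 2 * (l : ℝ) < T → vecLaw M v l = 0) →
      x / (1 - x) * windowS x T j M (vecLaw M v) J = ∑ h ∈ Finset.Ico (J + 1) (M + 1), vecLaw M v h →
      0 < ∑ h ∈ Finset.Ico (J + 1) (M + 1), vecLaw M v h →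
      pieceG x T j M l₁ h₁ l₂ h₂ g₁ g₂ t₁ t₂ s₁ s₂ r J = 0)
    (bstar : ℕ) (hbM : bstar ≤ M)
    (hbne : pertLaw x T j (vecLaw M v) l₁ h₁ l₂ h₂ g₁ g₂ l₀ t₁ t₂ s₁ s₂ r bstar - vecLaw M v bstar ≠ 0) :
    ∃ s : ℝ, s ≠ 0 ∧
      (∀ b, b ≤ M → pertLaw x T j (vecLaw M v) l₁ h₁ l₂ h₂ g₁ g₂ l₀ t₁ t₂ s₁ s₂ r b - vecLaw M v b = s * vecLaw M v b) ∧
      (∀ k, vecLaw M v k ≠ 0 →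
        (t₁ ≠ 0 ∧ (k = l₁ ∨ k = h₁)) ∨ (t₂ ≠ 0 ∧ (k = l₂ ∨ k = h₂)) ∨ (s₁ ≠ 0 ∧ k = g₁) ∨ (s₂ ≠ 0 ∧ k = g₂) ∨ (r ≠ 0 ∧ k = l₀)) := by
  have hv : v ∈ windowSet x T M j w := hvext.1
  -- the move and its negative
  obtain ⟨α, hα, hplus⟩ := exists_oneSided x T M j w v hx0 hx1 hv l₁ h₁ l₂ h₂ g₁ g₂ l₀ t₁ t₂ s₁ s₂ r hσ₁ hσ₂ hg₁ hg₂ hl₀ hG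
  obtain ⟨β, hβ, hminus⟩ := exists_oneSided x T M j w v hx0 hx1 hv l₁ h₁ l₂ h₂ g₁ g₂ l₀ (-t₁) (-t₂) (-s₁) (-s₂) (-r)
    (fun ht => hσ₁ (fun h0 => ht (by rw [h0, neg_zero]))) (fun ht => hσ₂ (fun h0 => ht (by rw [h0, neg_zero])))
    (fun hs => hg₁ (fun h0 => hs (by rw [h0, neg_zero]))) (fun hs => hg₂ (fun h0 => hs (by rw [h0, neg_zero])))
    (fun hr => hl₀ (fun h0 => hr (by rw [h0, neg_zero])))
    (fun J hJ hw hgap hS hΓ => by rw [pieceG_neg, hG J hJ hw hgap hS hΓ, neg_zero])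
  have hminus' : (fun i : Fin (M + 1) => v i - β * pertD x T j M v l₁ h₁ l₂ h₂ g₁ g₂ l₀ t₁ t₂ s₁ s₂ r i) ∈ windowSet x T M j w := by
    have e : (fun i : Fin (M + 1) => v i + β * pertD x T j M v l₁ h₁ l₂ h₂ g₁ g₂ l₀ (-t₁) (-t₂) (-s₁) (-s₂) (-r) i)
        = fun i : Fin (M + 1) => v i - β * pertD x T j M v l₁ h₁ l₂ h₂ g₁ g₂ l₀ t₁ t₂ s₁ s₂ r i := by
      funext i; rw [pertD_neg]; ring
    rw [e] at hminus; exact hminus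
  -- extremality: the direction vanishes on `{0..M}`
  have hD := dir_eq_zero_of_extreme hvext (fun i => pertD x T j M v l₁ h₁ l₂ h₂ g₁ g₂ l₀ t₁ t₂ s₁ s₂ r i) hα hβ hplus hminus'
  set δ : ℕ → ℝ := fun b => pertLaw x T j (vecLaw M v) l₁ h₁ l₂ h₂ g₁ g₂ l₀ t₁ t₂ s₁ s₂ r b - vecLaw M v b with hδ
  set s : ℝ := ∑ k ∈ Finset.range (M + 1), δ k with hs
  have hprop : ∀ b, b ≤ M → δ b = s * vecLaw M v b := by
    intro b hb
    have := hD ⟨b, Nat.lt_succ_of_le hb⟩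
    unfold pertD at this
    simp only at this
    linarith
  have hs0 : s ≠ 0 := by
    intro hz
    have := hprop bstar hbM
    rw [hz, zero_mul] at this
    exact hbne this
  refine ⟨s, hs0, hprop, fun k hk => pert_support x T j (vecLaw M v) l₁ h₁ l₂ h₂ g₁ g₂ l₀ t₁ t₂ s₁ s₂ r k ?_⟩
  have hkM : k ≤ M := by
    by_contra hgt; push Not at hgt
    exact hk (vecLaw_apply_of_gt v hgt)
  show δ k ≠ 0
  rw [hprop k hkM]
  exact mul_ne_zero hs0 hk



/-- rescaling a proportionality between two probability vectors on `{0..M}`. -/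
theorem eq_of_smul_eq_smul {M : ℕ} {s L : ℝ} {μ A : ℕ → ℝ} (hs : s ≠ 0)
    (h : ∀ b, b ≤ M → s * μ b = A b * L) (hμ : ∑ b ∈ Finset.range (M + 1), μ b = 1)
    (hA : ∑ b ∈ Finset.range (M + 1), A b = 1) : ∀ b, b ≤ M → μ b = A b := by
  have hsL : s = L := by
    have e1 : s = ∑ b ∈ Finset.range (M + 1), s * μ b := by rw [← Finset.mul_sum, hμ, mul_one]
    have e2 : L = ∑ b ∈ Finset.range (M + 1), A b * L := by rw [← Finset.sum_mul, hA, one_mul]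
    rw [e1, e2]
    exact Finset.sum_congr rfl fun b hb => h b (Nat.lt_succ_iff.1 (Finset.mem_range.1 hb))
  intro b hb
  have := h b hb
  rw [← hsL, mul_comm (A b)] at this
  exact mul_left_cancel₀ hs this


/-! ### Cases (C) and (A) of memo WINDOW-ATOMS-G57 §2.4, read structurally -/

/-- **CASE (C): NO SATURATED LAYER ⟹ at most one low of the top layer** (one elementary piece is proportional to the law). [this work] -/
theorem atMostOneLow_of_noTight (x T : ℝ) (M j w : ℕ) (v : Fin (M + 1) → ℝ) (hx0 : 0 < x) (hx1 : x < 1)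
    (hvext : v ∈ (windowSet x T M j w).extremePoints ℝ)
    (hno : ∀ J, J ≤ j → j ≤ J + w → (∀ l, J < l → l ≤ j → 2 * (l : ℝ) < T → vecLaw M v l = 0) →
      x / (1 - x) * windowS x T j M (vecLaw M v) J = ∑ h ∈ Finset.Ico (J + 1) (M + 1), vecLaw M v h →
      0 < ∑ h ∈ Finset.Ico (J + 1) (M + 1), vecLaw M v h → False) :
    ∃ q, q ≤ j ∧ ∀ k, k ≤ j → 2 * (k : ℝ) < T → vecLaw M v k ≠ 0 → k = q := by
  classical
  have hv : v ∈ windowSet x T M j w := hvext.1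
  set μ : ℕ → ℝ := vecLaw M v with hμdef
  have hμ0 : ∀ k, 0 ≤ μ k := fun k => by
    by_cases hk : k < M + 1
    · rw [hμdef, vecLaw_apply_of_lt v hk]; exact hv.1 _
    · rw [hμdef, vecLaw, dif_neg hk]
  have hμM : ∀ h, M < h → μ h = 0 := fun h hh => vecLaw_apply_of_gt v hh
  have hμ1 : ∑ h ∈ Finset.range (M + 1), μ h = 1 := by rw [hμdef, sum_range_vecLaw, hv.2.1]
  have hwin : ∀ J, J ≤ j → j ≤ J + w → DECAtT x T J M μ := hv.2.2
  have hu : 0 < x / (1 - x) := div_pos hx0 (by linarith)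
  obtain ⟨hF0, hsup, hrow, hcol⟩ := cornerFlow_inv x T j M μ hx0 hx1 hμ0 ((j + 1) * (j + 1)) le_rfl
  have hleM : ∀ b, 0 < μ b → b ≤ M := fun b hb => by
    by_contra hgt; push Not at hgt; linarith [hμM b hgt]
  have hG : ∀ J, J ≤ j → j ≤ J + w → (∀ l, J < l → l ≤ j → 2 * (l : ℝ) < T → μ l = 0) →
      x / (1 - x) * windowS x T j M μ J = ∑ h ∈ Finset.Ico (J + 1) (M + 1), μ h →
      0 < ∑ h ∈ Finset.Ico (J + 1) (M + 1), μ h → ∀ G : ℝ, G = 0 :=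
    fun J h1 h2 h3 h4 h5 _ => (hno J h1 h2 h3 h4 h5).elim
  have hloadgiant : ∀ g, j < g → ∑ a ∈ Finset.range (j + 1), usage x T j a g * cornerMidFlow x T j M μ a g = 0 := by
    intro g hg
    refine Finset.sum_eq_zero fun a _ => ?_
    by_cases hz : cornerMidFlow x T j M μ a g = 0
    · rw [hz, mul_zero]
    · have := (hsup a g hz).2.1; omega
  by_cases hgiant : ∃ g, j < g ∧ g ≤ M ∧ μ g ≠ 0
  · -- (C1) a giant of positive mass: the law is `δ_g`, no low at all
    obtain ⟨g, hjg, hgM, hgne⟩ := hgiant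
    have hgpos : 0 < μ g := lt_of_le_of_ne (hμ0 g) (Ne.symm hgne)
    obtain ⟨s, hs0, -, hnames⟩ := law_eq_of_pieces x T M j w v hx0 hx1 hvext 0 0 0 0 g 0 0 0 0 1 0 0
      (fun h => absurd rfl h) (fun h => absurd rfl h)
      (fun _ => ⟨hgM, fun hc => by omega, by rw [← hμdef, hloadgiant g hjg, sub_zero]; exact hgpos⟩)
      (fun h => absurd rfl h) (fun h => absurd rfl h)
      (fun J h1 h2 h3 h4 h5 => hG J h1 h2 h3 h4 h5 _) g hgM (by unfold pertLaw; simp)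
    refine ⟨0, Nat.zero_le _, fun k hkj _ hk => ?_⟩
    rcases hnames k hk with ⟨ht, -⟩ | ⟨ht, -⟩ | ⟨-, hk'⟩ | ⟨hs, -⟩ | ⟨hr, -⟩
    · exact absurd rfl ht
    · exact absurd rfl ht
    · omega
    · exact absurd rfl hs
    · exact absurd rfl hr
  · push Not at hgiant
    have hΓj : ∑ h ∈ Finset.Ico (j + 1) (M + 1), μ h = 0 :=
      Finset.sum_eq_zero fun h hh => by
        obtain ⟨q1, q2⟩ := Finset.mem_Ico.1 hh
        exact hgiant h (by omega) (by omega)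
    have hleft0 : ∀ l, 0 ≤ cornerLeftover x T j M μ l := fun l => by
      unfold cornerLeftover cornerMidFlow; linarith [hrow l]
    have hCj := (decAtT_iff_cornerSucceeds x T j M μ hx0 hx1 hμ0 hμM hμ1).1 (hwin j le_rfl (Nat.le_add_right _ _))
    unfold CornerSucceeds at hCj
    rw [hΓj] at hCj
    have hLsum : ∑ l ∈ (Finset.range (j + 1)).filter (fun l : ℕ => 2 * (l : ℝ) < T), cornerLeftover x T j M μ l = 0 := by
      have h0 : 0 ≤ ∑ l ∈ (Finset.range (j + 1)).filter (fun l : ℕ => 2 * (l : ℝ) < T), cornerLeftover x T j M μ l :=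
        Finset.sum_nonneg fun l _ => hleft0 l
      nlinarith
    have hLz : ∀ l, l ≤ j → 2 * (l : ℝ) < T → cornerLeftover x T j M μ l = 0 := fun l hl hlow =>
      (Finset.sum_eq_zero_iff_of_nonneg (fun l _ => hleft0 l)).1 hLsum l
        (Finset.mem_filter.2 ⟨Finset.mem_range.2 (Nat.lt_succ_of_le hl), hlow⟩)
    by_cases hseg : ∃ l h, 0 < cornerMidFlow x T j M μ l h
    · -- (C2) a corner segment: the law is the segment, one low
      obtain ⟨l, h, hF⟩ := hseg
      obtain ⟨q1, q2, q3, q4, q5, -⟩ := hsup l h (ne_of_gt hF)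
      have hlh : l ≠ h := by
        intro e; have : (l : ℝ) = h := by exact_mod_cast e
        linarith
      have hlM : l ≤ M := by
        have hle := Finset.single_le_sum (f := fun b => cornerFlow x T j M μ ((j + 1) * (j + 1)) l b) (fun b _ => hF0 l b)
          (Finset.mem_range.2 (Nat.lt_succ_of_le q4))
        have hF' : 0 < cornerFlow x T j M μ ((j + 1) * (j + 1)) l h := hF
        exact hleM l (by linarith [hrow l])
      obtain ⟨s, hs0, -, hnames⟩ := law_eq_of_pieces x T M j w v hx0 hx1 hvext l h 0 0 0 0 0 1 0 0 0 0
        (fun _ => hF) (fun h => absurd rfl h) (fun h => absurd rfl h) (fun h => absurd rfl h) (fun h => absurd rfl h)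
        (fun J h1 h2 h3 h4 h5 => hG J h1 h2 h3 h4 h5 _) l hlM (by unfold pertLaw; rw [if_pos rfl, if_neg hlh]; simp)
      refine ⟨l, q1, fun k hkj hklow hk => ?_⟩
      rcases hnames k hk with ⟨-, hk'⟩ | ⟨ht, -⟩ | ⟨hs, -⟩ | ⟨hs, -⟩ | ⟨hr, -⟩
      · rcases hk' with e | e
        · exact e
        · exfalso; rw [e] at hklow; linarith
      · exact absurd rfl ht
      · exact absurd rfl hs
      · exact absurd rfl hs
      · exact absurd rfl hr
    · -- (C3) no segment, no giant mass: the law is an absorber point, no low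
      push Not at hseg
      have hFz : ∀ l h, cornerMidFlow x T j M μ l h = 0 := fun l h => le_antisymm (hseg l h) (hF0 l h)
      obtain ⟨b, hbmem, hbne⟩ : ∃ b ∈ Finset.range (M + 1), μ b ≠ 0 :=
        Finset.exists_ne_zero_of_sum_ne_zero (by rw [hμ1]; exact one_ne_zero)
      have hbM : b ≤ M := Nat.lt_succ_iff.1 (Finset.mem_range.1 hbmem)
      have hbpos : 0 < μ b := lt_of_le_of_ne (hμ0 b) (Ne.symm hbne)
      have hbj : b ≤ j := by
        by_contra hgt; push Not at hgt; exact hbne (hgiant b hgt hbM)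
      have hnotlow : ¬ (2 * (b : ℝ) < T ∧ b ≤ j) := by
        rintro ⟨hlow, -⟩
        have hL := hLz b hbj hlow
        unfold cornerLeftover at hL
        rw [Finset.sum_eq_zero (fun h _ => hFz b h)] at hL
        exact hbne (by linarith)
      have hload0 : ∑ a ∈ Finset.range (j + 1), usage x T j a b * cornerMidFlow x T j M μ a b = 0 :=
        Finset.sum_eq_zero fun a _ => by rw [hFz a b, mul_zero]
      obtain ⟨s, hs0, -, hnames⟩ := law_eq_of_pieces x T M j w v hx0 hx1 hvext 0 0 0 0 b 0 0 0 0 1 0 0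
        (fun h => absurd rfl h) (fun h => absurd rfl h)
        (fun _ => ⟨hbM, hnotlow, by rw [← hμdef, hload0, sub_zero]; exact hbpos⟩)
        (fun h => absurd rfl h) (fun h => absurd rfl h)
        (fun J h1 h2 h3 h4 h5 => hG J h1 h2 h3 h4 h5 _) b hbM (by unfold pertLaw; simp)
      refine ⟨0, Nat.zero_le _, fun k hkj hklow hk => ?_⟩
      rcases hnames k hk with ⟨ht, -⟩ | ⟨ht, -⟩ | ⟨-, hk'⟩ | ⟨hs, -⟩ | ⟨hr, -⟩
      · exact absurd rfl ht
      · exact absurd rfl ht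
      · exfalso; rw [hk'] at hklow hkj; exact hnotlow ⟨hklow, hkj⟩
      · exact absurd rfl hs
      · exact absurd rfl hr


/-- **CASE (A): A SATURATED LAYER AND A GIANT ABOVE THE TOP ⟹ at most one low.** [this work] -/
theorem atMostOneLow_of_tight_giant (x T : ℝ) (M j w : ℕ) (v : Fin (M + 1) → ℝ) (hx0 : 0 < x) (hx1 : x < 1)
    (hvext : v ∈ (windowSet x T M j w).extremePoints ℝ) (Js : ℕ)
    (hS : x / (1 - x) * windowS x T j M (vecLaw M v) Js = ∑ h ∈ Finset.Ico (Js + 1) (M + 1), vecLaw M v h)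
    (hΓ : 0 < ∑ h ∈ Finset.Ico (Js + 1) (M + 1), vecLaw M v h)
    (hmax : ∀ J, J ≤ j → j ≤ J + w → (∀ l, J < l → l ≤ j → 2 * (l : ℝ) < T → vecLaw M v l = 0) →
      x / (1 - x) * windowS x T j M (vecLaw M v) J = ∑ h ∈ Finset.Ico (J + 1) (M + 1), vecLaw M v h →
      0 < ∑ h ∈ Finset.Ico (J + 1) (M + 1), vecLaw M v h → J ≤ Js)
    (g : ℕ) (hjg : j < g) (hgM : g ≤ M) (hgne : vecLaw M v g ≠ 0) :
    ∃ q, q ≤ j ∧ ∀ k, k ≤ j → 2 * (k : ℝ) < T → vecLaw M v k ≠ 0 → k = q := by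
  classical
  have hv : v ∈ windowSet x T M j w := hvext.1
  set μ : ℕ → ℝ := vecLaw M v with hμdef
  have hμ0 : ∀ k, 0 ≤ μ k := fun k => by
    by_cases hk : k < M + 1
    · rw [hμdef, vecLaw_apply_of_lt v hk]; exact hv.1 _
    · rw [hμdef, vecLaw, dif_neg hk]
  have hμM : ∀ h, M < h → μ h = 0 := fun h hh => vecLaw_apply_of_gt v hh
  have hu : 0 < x / (1 - x) := div_pos hx0 (by linarith)
  obtain ⟨hF0, hsup, hrow, hcol⟩ := cornerFlow_inv x T j M μ hx0 hx1 hμ0 ((j + 1) * (j + 1)) le_rfl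
  have hleM : ∀ b, 0 < μ b → b ≤ M := fun b hb => by
    by_contra hgt; push Not at hgt; linarith [hμM b hgt]
  have hleft0 : ∀ l, 0 ≤ cornerLeftover x T j M μ l := fun l => by
    unfold cornerLeftover cornerMidFlow; linarith [hrow l]
  have hLft_le : ∀ l, cornerLeftover x T j M μ l ≤ μ l := fun l => by
    have : 0 ≤ ∑ b ∈ Finset.range (M + 1), cornerFlow x T j M μ ((j + 1) * (j + 1)) l b :=
      Finset.sum_nonneg fun b _ => hF0 l b
    unfold cornerLeftover cornerMidFlow; linarith
  have hgpos : 0 < μ g := lt_of_le_of_ne (hμ0 g) (Ne.symm hgne)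
  have hloadg : ∑ a ∈ Finset.range (j + 1), usage x T j a g * cornerMidFlow x T j M μ a g = 0 := by
    refine Finset.sum_eq_zero fun a _ => ?_
    by_cases hz : cornerMidFlow x T j M μ a g = 0
    · rw [hz, mul_zero]
    · have := (hsup a g hz).2.1; omega
  have hresg : 0 < μ g - ∑ a ∈ Finset.range (j + 1), usage x T j a g * cornerMidFlow x T j M μ a g := by
    rw [hloadg, sub_zero]; exact hgpos
  have hSpos : 0 < windowS x T j M μ Js := by
    by_contra hle; push Not at hle; nlinarith
  obtain ⟨l₀, hl₀mem, hl₀ne⟩ := Finset.exists_ne_zero_of_sum_ne_zero (ne_of_gt hSpos)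
  obtain ⟨hl₀r, hl₀low⟩ := Finset.mem_filter.1 hl₀mem
  have hl₀j : l₀ ≤ j := Nat.lt_succ_iff.1 (Finset.mem_range.1 hl₀r)
  by_cases hL : 0 < cornerLeftover x T j M μ l₀
  · -- (A1) the pieces `u·e_g + e_{l₀}`: the only low is `l₀`
    have hl₀M : l₀ ≤ M := hleM l₀ (lt_of_lt_of_le hL (hLft_le l₀))
    have hl₀g : l₀ ≠ g := by omega
    have hpc : ∀ J, J ≤ j → j ≤ J + w → (∀ l, J < l → l ≤ j → 2 * (l : ℝ) < T → μ l = 0) →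
        x / (1 - x) * windowS x T j M μ J = ∑ h ∈ Finset.Ico (J + 1) (M + 1), μ h →
        0 < ∑ h ∈ Finset.Ico (J + 1) (M + 1), μ h →
        pieceG x T j M 0 0 0 0 g 0 0 0 (x / (1 - x)) 0 1 J = 0 := by
      intro J h1 _ _ _ _
      unfold pieceG
      rw [if_pos (show J < g ∧ g ≤ M from ⟨by omega, hgM⟩)]
      simp only [zero_mul, mul_zero, ite_self]
      ring
    have hbne : pertLaw x T j μ 0 0 0 0 g 0 l₀ 0 0 (x / (1 - x)) 0 1 l₀ - μ l₀ ≠ 0 := by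
      unfold pertLaw; rw [if_neg hl₀g, if_pos rfl]; simp
    obtain ⟨s, hs0, -, hnames⟩ := law_eq_of_pieces x T M j w v hx0 hx1 hvext 0 0 0 0 g 0 l₀ 0 0 (x / (1 - x)) 0 1
      (fun h => absurd rfl h) (fun h => absurd rfl h)
      (fun _ => ⟨hgM, fun hc => by omega, hresg⟩) (fun h => absurd rfl h)
      (fun _ => ⟨hl₀low, hl₀j, hL⟩) hpc l₀ hl₀M hbne
    refine ⟨l₀, hl₀j, fun k hkj _ hk => ?_⟩
    rcases hnames k hk with ⟨ht, -⟩ | ⟨ht, -⟩ | ⟨-, hk'⟩ | ⟨hs, -⟩ | ⟨-, hk'⟩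
    · exact absurd rfl ht
    · exact absurd rfl ht
    · omega
    · exact absurd rfl hs
    · exact hk'
  · -- (A2) a corner segment `(l₀, h₀)` beyond `J*` and the giant: the only low is `l₀`
    have hL0 : cornerLeftover x T j M μ l₀ = 0 := le_antisymm (not_lt.1 hL) (hleft0 l₀)
    rw [hL0, zero_add] at hl₀ne
    obtain ⟨h₀, hh₀mem, hh₀ne⟩ := Finset.exists_ne_zero_of_sum_ne_zero hl₀ne
    have hcond : Js < h₀ ∧ h₀ ≤ j := by
      by_contra hc; rw [if_neg hc] at hh₀ne; exact hh₀ne rfl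
    rw [if_pos hcond] at hh₀ne
    have hF : 0 < cornerMidFlow x T j M μ l₀ h₀ := lt_of_le_of_ne (hF0 l₀ h₀) (Ne.symm hh₀ne)
    obtain ⟨q1, q2, q3, q4, q5, -⟩ := hsup l₀ h₀ hh₀ne
    have hl₀M : l₀ ≤ M := by
      have hle := Finset.single_le_sum (f := fun b => cornerFlow x T j M μ ((j + 1) * (j + 1)) l₀ b) (fun b _ => hF0 l₀ b)
        (Finset.mem_range.2 (Nat.lt_succ_of_le q4))
      have hF' : 0 < cornerFlow x T j M μ ((j + 1) * (j + 1)) l₀ h₀ := hF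
      exact hleM l₀ (by linarith [hrow l₀])
    have hl₀h₀ : l₀ ≠ h₀ := by
      intro e; have : (l₀ : ℝ) = h₀ := by exact_mod_cast e
      linarith
    have hl₀g : l₀ ≠ g := by omega
    set c₀ := usage x T j l₀ h₀ with hc₀
    have hpc : ∀ J, J ≤ j → j ≤ J + w → (∀ l, J < l → l ≤ j → 2 * (l : ℝ) < T → μ l = 0) →
        x / (1 - x) * windowS x T j M μ J = ∑ h ∈ Finset.Ico (J + 1) (M + 1), μ h →
        0 < ∑ h ∈ Finset.Ico (J + 1) (M + 1), μ h →
        pieceG x T j M l₀ h₀ 0 0 g 0 1 0 (x / (1 - x) - c₀) 0 0 J = 0 := by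
      intro J h1 h2 h3 h4 h5
      have hJle : J ≤ Js := hmax J h1 h2 h3 h4 h5
      unfold pieceG
      rw [if_pos (show J < h₀ ∧ h₀ ≤ M from ⟨by omega, q4⟩), if_pos (show J < h₀ by omega),
        if_pos (show J < g ∧ g ≤ M from ⟨by omega, hgM⟩)]
      simp only [zero_mul, mul_zero, ite_self]
      ring
    have hbne : pertLaw x T j μ l₀ h₀ 0 0 g 0 0 1 0 (x / (1 - x) - c₀) 0 0 l₀ - μ l₀ ≠ 0 := by
      unfold pertLaw; rw [if_pos rfl, if_neg hl₀h₀, if_neg hl₀g]; simp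
    obtain ⟨s, hs0, -, hnames⟩ := law_eq_of_pieces x T M j w v hx0 hx1 hvext l₀ h₀ 0 0 g 0 0 1 0 (x / (1 - x) - c₀) 0 0
      (fun _ => hF) (fun h => absurd rfl h)
      (fun _ => ⟨hgM, fun hc => by omega, hresg⟩) (fun h => absurd rfl h) (fun h => absurd rfl h) hpc l₀ hl₀M hbne
    refine ⟨l₀, hl₀j, fun k hkj hklow hk => ?_⟩
    rcases hnames k hk with ⟨-, hk'⟩ | ⟨ht, -⟩ | ⟨-, hk'⟩ | ⟨hs, -⟩ | ⟨hr, -⟩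
    · rcases hk' with e | e
      · exact e
      · exfalso; rw [e] at hklow; linarith
    · exact absurd rfl ht
    · omega
    · exact absurd rfl hs
    · exact absurd rfl hr




end LawDec

end Quant

end Summit.CriticalPhenomena.PercolationContinuityZ3.Theorems
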